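import Literature.Geometry.Riemannian.CurveAdaptedOrthonormalFrame
import Literature.Topology.FourManifolds.FrameAlongLoopOrientation
import Literature.Geometry.Lorentzian.GeodesicProofs
import HarnessLib

/-!
# Monodromy of an adapted orthonormal frame along a closed curve in an oriented 4-manifold

Topic `Literature/Geometry/Riemannian`.  Let `γ : ℝ → M` be a `C^∞`, regular, `T`-periodic curve
in a Riemannian `4`-manifold carrying a `SmoothOrientation`.  `CurveAdaptedOrthonormalFrame.lean`
gives on the window `(-T, 2T)` a smooth orthonormal frame `ν₀, …, ν₃` along `γ` with `ν₀` the
unit tangent.  Here we compare the frame at `s` and at `s + T` (`s ∈ (-T, T)`, same point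
`γ s = γ (s + T)` of `M`):

* `velocity_add_period` — `γ'(s + T) = γ'(s)`; hence `ν₀ (s + T) = ν₀ s`;
* the **monodromy** `P(s)`, `ν_a(s + T) = ∑_b P(s)_{ab} ν_b(s)` (`a, b = 1, 2, 3`), has `C^∞`
  entries, is ORTHOGONAL, and has DETERMINANT ONE — the last point because a continuous frame
  along a loop in an oriented manifold returns with positive determinant
  (`FrameAlongLoopOrientation.det_pos_of_frame_along_loop`): `exists_frame_monodromy`.

This is the statement "the normal bundle of an embedded circle in an orientable manifold is
orientable, hence trivial" in the concrete form needed to build `T`-periodic normal frames and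
tubular neighbourhood maps `S¹ × D³ → M` (Hirsch, *Differential Topology* (1976), Ch. 4, §4–§5,
Thm. 5.2 ff.; Lee, *Introduction to Riemannian Manifolds* (2018), Thm. 5.25).  Everything is proved;
no definitions, no named facts.

## References

* M. W. Hirsch, *Differential Topology*, GTM 33 (1976), Ch. 4, §4 (orientations), §5 (tubular
  neighbourhoods). [HirschDT1976]
* B. O'Neill, *Semi-Riemannian geometry*, Academic Press (1983), Ch. 3, Lemma 3.20. [ONeill1983]
-/

noncomputable section

open Bundle Set Filter Function Module Matrix
open scoped Manifold ContDiff Topology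

namespace Literature.Geometry.Riemannian

open Literature.Geometry.Lorentzian Literature.Topology.FourManifolds

variable {E : Type*} [NormedAddCommGroup E] [NormedSpace ℝ E]
  {H : Type*} [TopologicalSpace H] {I : ModelWithCorners ℝ E H}
  {M : Type*} [TopologicalSpace M] [ChartedSpace H M] [IsManifold I ∞ M]

/-! ### Periodic curves -/

omit [IsManifold I ∞ M] in
/-- The velocity of a `T`-periodic curve is `T`-periodic. [folklore] -/
theorem velocity_add_period {γ : ℝ → M} {T : ℝ} (hper : ∀ t, γ (t + T) = γ t) (t : ℝ) :
    velocity I γ (t + T) = velocity I γ t := by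
  have h := velocity_comp_affine (I := I) γ 1 T t
  have hf : (fun t ↦ γ (1 * t + T)) = γ := funext fun t ↦ by rw [one_mul, hper]
  rw [hf, one_smul, one_mul] at h
  exact h.symm

omit [IsManifold I ∞ M] in
/-- Values of a field along a curve at equal parameters agree (as vectors of the model space;
the field has the dependent type `Π t, T_{γ t}M`). [folklore] -/
theorem frame_congr_arg {γ : ℝ → M} (ν : Π t : ℝ, TangentSpace I (γ t)) {t₁ t₂ : ℝ}
    (h : t₁ = t₂) : (ν t₁ : E) = ν t₂ := by
  subst h
  rfl

omit [IsManifold I ∞ M] in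
/-- Shifting the parameter by a period does not change the lift of a field along a periodic
curve, as a point of `TM`. [folklore] -/
theorem totalSpaceMk_add_period {γ : ℝ → M} {T : ℝ} (hper : ∀ t, γ (t + T) = γ t) (t : ℝ)
    (v : TangentSpace I (γ (t + T))) :
    (TotalSpace.mk' E (γ (t + T)) v : TangentBundle I M) = TotalSpace.mk' E (γ t) v := by
  rw [hper]

/-! ### The monodromy -/

section Monodromy

variable [FiniteDimensional ℝ E] [CompleteSpace E]
  {cov : CovariantDerivative I E (TangentSpace I : M → Type _)}
  (g : PseudoRiemannianMetric I ∞ E (TangentSpace I : M → Type _))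

/-- Determinant of the `(1 + 3)`-block matrix `[[1, 0], [0, P]]` on `Fin 4`. [folklore] -/
theorem det_blockOnePThree (P : Matrix (Fin 3) (Fin 3) ℝ) :
    (Matrix.of fun i j : Fin 4 ↦ Fin.cases (Fin.cases (1 : ℝ) (fun _ ↦ 0) j)
      (fun a ↦ Fin.cases (0 : ℝ) (fun b ↦ P a b) j) i).det = P.det := by
  rw [Matrix.det_succ_row_zero, Fin.sum_univ_succ]
  simp only [Matrix.of_apply, Fin.cases_zero, Fin.cases_succ, Fin.val_zero, pow_zero, one_mul,
    mul_zero, zero_mul, Finset.sum_const_zero, add_zero, Fin.succAbove_zero]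
  congr 1

/-- **Monodromy of the adapted frame along a closed curve in an oriented `4`-manifold.**  For a
`C^∞`, regular, `T`-periodic curve `γ` (`T > 0`) in a Riemannian `4`-manifold with a
`SmoothOrientation` and a metric-compatible locally `C^∞` connection: there are fields `ν₀, …, ν₃`
along `γ`, `g`-orthonormal with `C^∞` lifts on `(-T, 2T)`, `ν₀ = γ'/|γ'|`, and a matrix function
`P : ℝ → M₃(ℝ)` such that for `s ∈ (-T, T)`: `ν₀(s + T) = ν₀(s)`,
`ν_{a+1}(s + T) = ∑_b P(s)_{ab} ν_{b+1}(s)`, the entries of `P` are `C^∞` at `s`, `P(s)ᵀ P(s) = 1`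
and `det P(s) = 1` (Hirsch 1976, Ch. 4 §4: orientability of the normal bundle of a loop in an
oriented manifold; O'Neill 1983, Ch. 3, Lemma 3.20). [cite: HirschDT1976, Ch. 4 §4] -/
theorem exists_frame_monodromy (hg : g.IsRiemannian) (hcov : g.IsCompatible cov)
    (hreg : cov.IsLocallyContMDiff ∞) (hE : finrank ℝ E = 4) (o : SmoothOrientation I M)
    {γ : ℝ → M} (hγ : ContMDiff 𝓘(ℝ, ℝ) I ∞ γ) {T : ℝ} (hT : 0 < T)
    (hper : ∀ t, γ (t + T) = γ t) (hvel : ∀ t, velocity I γ t ≠ 0) :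
    ∃ (ν : Fin 4 → Π t : ℝ, TangentSpace I (γ t)) (P : ℝ → Matrix (Fin 3) (Fin 3) ℝ),
      (∀ t ∈ Ioo (-T) (2 * T), ∀ i j, g.val (γ t) (ν i t) (ν j t) = if i = j then 1 else 0) ∧
      (∀ i, ∀ t ∈ Ioo (-T) (2 * T), ContMDiffAt 𝓘(ℝ, ℝ) I.tangent ∞
        (fun t' ↦ (TotalSpace.mk' E (γ t') (ν i t') : TangentBundle I M)) t) ∧
      (∀ t ∈ Ioo (-T) (2 * T), ν 0 t =
        (Real.sqrt (g.val (γ t) (velocity I γ t) (velocity I γ t)))⁻¹ • velocity I γ t) ∧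
      (∀ s ∈ Ioo (-T) T, ν 0 (s + T) = ν 0 s) ∧
      (∀ s ∈ Ioo (-T) T, ∀ a : Fin 3, ν a.succ (s + T) = ∑ b : Fin 3, P s a b • ν b.succ s) ∧
      (∀ a b, ∀ s ∈ Ioo (-T) T, ContMDiffAt 𝓘(ℝ, ℝ) 𝓘(ℝ, ℝ) ∞ (fun s' ↦ P s' a b) s) ∧
      (∀ s ∈ Ioo (-T) T, (P s)ᵀ * P s = 1 ∧ (P s).det = 1) := by
  classical
  have h0W : (0 : ℝ) ∈ Ioo (-T) (2 * T) := ⟨by linarith, by linarith⟩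
  obtain ⟨ν, hon, hsm, hν0⟩ := exists_orthonormal_frame_unitTangent g hg hcov hreg hE hγ h0W
    (fun t _ ↦ hvel t)
  have hcard : Fintype.card (Fin 4) = finrank ℝ E := by rw [Fintype.card_fin, hE]
  -- windows
  have hsW : ∀ s ∈ Ioo (-T) T, s ∈ Ioo (-T) (2 * T) := fun s hs ↦ ⟨hs.1, by linarith [hs.2]⟩
  have hsTW : ∀ s ∈ Ioo (-T) T, s + T ∈ Ioo (-T) (2 * T) := fun s hs ↦
    ⟨by linarith [hs.1], by linarith [hs.2]⟩
  -- (1) `ν₀` is periodic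
  have hν0per : ∀ s ∈ Ioo (-T) T, ν 0 (s + T) = ν 0 s := by
    intro s hs
    rw [hν0 _ (hsTW s hs), hν0 _ (hsW s hs), velocity_add_period hper, hper]
  -- (2) the monodromy matrix
  set P : ℝ → Matrix (Fin 3) (Fin 3) ℝ :=
    fun s a b ↦ g.val (γ s) (ν a.succ (s + T)) (ν b.succ s) with hP
  -- expansion of `ν_{a+1}(s + T)` in the frame at `s`
  have hcoef0 : ∀ s ∈ Ioo (-T) T, ∀ a : Fin 3, g.val (γ s) (ν a.succ (s + T)) (ν 0 s) = 0 := by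
    intro s hs a
    rw [← hν0per s hs, ← hper s, hon _ (hsTW s hs)]
    simp [Fin.succ_ne_zero]
  have hexp : ∀ s ∈ Ioo (-T) T, ∀ a : Fin 3,
      ν a.succ (s + T) = ∑ b : Fin 3, P s a b • ν b.succ s := by
    intro s hs a
    have h := eq_sum_val_smul g (hon s (hsW s hs)) hcard (ν a.succ (s + T))
    rw [Fin.sum_univ_succ, hcoef0 s hs a, zero_smul, zero_add] at h
    exact h
  -- (3) orthogonality: `P Pᵀ = 1`, hence `Pᵀ P = 1`
  have hon3 : ∀ s ∈ Ioo (-T) (2 * T), ∀ a b : Fin 3,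
      g.val (γ s) (ν a.succ s) (ν b.succ s) = if a = b then 1 else 0 := by
    intro s hs a b
    rw [hon s hs]
    simp only [Fin.succ_inj]
  have hPPt : ∀ s ∈ Ioo (-T) T, P s * (P s)ᵀ = 1 := by
    intro s hs
    ext a b
    have h1 : g.val (γ (s + T)) (ν a.succ (s + T)) (ν b.succ (s + T)) = if a = b then 1 else 0 :=
      hon3 _ (hsTW s hs) a b
    rw [hper s, hexp s hs a, hexp s hs b, val_sum_smul_sum_smul g (hon3 s (hsW s hs))] at h1
    rw [Matrix.mul_apply, Matrix.one_apply, ← h1]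
    simp only [Matrix.transpose_apply]
  have hPtP : ∀ s ∈ Ioo (-T) T, (P s)ᵀ * P s = 1 := fun s hs ↦ mul_eq_one_comm.1 (hPPt s hs)
  -- (4) smoothness of the entries
  have hPsm : ∀ a b, ∀ s ∈ Ioo (-T) T, ContMDiffAt 𝓘(ℝ, ℝ) 𝓘(ℝ, ℝ) ∞ (fun s' ↦ P s' a b) s := by
    intro a b s hs
    have hA : ContMDiffAt 𝓘(ℝ, ℝ) I.tangent ∞
        (fun s' ↦ (TotalSpace.mk' E (γ s') (ν a.succ (s' + T)) : TangentBundle I M)) s := by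
      have h1 : ContMDiffAt 𝓘(ℝ, ℝ) I.tangent ∞
          (fun s' ↦ (TotalSpace.mk' E (γ (s' + T)) (ν a.succ (s' + T)) : TangentBundle I M)) s :=
        (hsm a.succ (s + T) (hsTW s hs)).comp s (contMDiffAt_id.add contMDiffAt_const)
      exact h1.congr_of_eventuallyEq (Eventually.of_forall fun s' ↦
        (totalSpaceMk_add_period hper s' _).symm)
    exact contMDiffAt_val_apply_along g le_rfl hA (hsm b.succ s (hsW s hs))
  -- (5) determinant one: positive by the orientation, `±1` by orthogonality
  have hdet : ∀ s ∈ Ioo (-T) T, (P s).det = 1 := by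
    intro s hs
    have hsq : (P s).det ^ 2 = 1 := by
      have h := congrArg Matrix.det (hPtP s hs)
      rwa [Matrix.det_mul, Matrix.det_transpose, Matrix.det_one, ← pow_two] at h
    have hpos : 0 < (P s).det := by
      -- the loop `r ↦ γ (s + clamp r)`, `clamp = projIcc 0 T`, and the frame `ν` along it
      set cl : ℝ → ℝ := fun r ↦ (projIcc 0 T hT.le r : ℝ) with hcl
      have hcl_mem : ∀ r, s + cl r ∈ Ioo (-T) (2 * T) := fun r ↦ by
        have h1 := (projIcc 0 T hT.le r).2
        exact ⟨by linarith [hs.1, h1.1], by linarith [hs.2, h1.2]⟩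
      have hclc : Continuous cl := continuous_subtype_val.comp continuous_projIcc
      set ι := finCongr hE with hι
      set f : ℝ → Fin (finrank ℝ E) → E := fun r k ↦ ν (ι k) (s + cl r) with hf
      have hfc : ∀ k, Continuous fun r ↦
          (TotalSpace.mk' E (γ (s + cl r)) (f r k) : TangentBundle I M) := by
        intro k
        refine continuous_iff_continuousAt.2 fun r ↦ ?_
        exact ContinuousAt.comp (f := fun r ↦ s + cl r)
          (g := fun t ↦ (TotalSpace.mk' E (γ t) (ν (ι k) t) : TangentBundle I M)) (x := r)
          ((hsm (ι k) _ (hcl_mem r)).continuousAt) (continuous_const.add hclc).continuousAt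
      have hfli : ∀ r, LinearIndependent ℝ (f r) := fun r ↦
        (linearIndependent_of_val_orthonormal g (hon _ (hcl_mem r))).comp _ ι.injective
      have hcl0 : cl 0 = 0 := by simp [hcl, projIcc_left]
      have hclT : cl T = T := by simp [hcl, projIcc_right]
      have hloop : γ (s + cl T) = γ (s + cl 0) := by rw [hclT, hcl0, add_zero, hper]
      -- the basis `B₀ = f 0` and the linear map `L` with `f T = L ∘ f 0`
      have hn : 0 < finrank ℝ E := by rw [hE]; norm_num
      obtain ⟨B₀, hB₀⟩ := exists_basis_of_frame hn hfli 0
      set L : E →ₗ[ℝ] E := B₀.constr ℝ (f T) with hL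
      have hLf : ∀ k, f T k = L (f 0 k) := fun k ↦ by
        rw [← hB₀, hL, Basis.constr_basis]
      have hdetL : 0 < LinearMap.det L :=
        det_pos_of_frame_along_loop o hn hfc hfli hloop hLf
      -- `det L = B₀.det (f T) = det [[1,0],[0,P s]] = det (P s)`
      have hdetL' : LinearMap.det L = B₀.det (f T) := by
        have h := B₀.det_comp L B₀
        rw [Basis.det_self, mul_one] at h
        rw [← h]
        congr 1
        funext k
        rw [Function.comp_apply, hB₀, hLf]
      -- coefficients of `f T k` in the basis `B₀`
      set Q : Matrix (Fin 4) (Fin 4) ℝ := Matrix.of fun i j : Fin 4 ↦ Fin.cases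
        (Fin.cases (1 : ℝ) (fun _ ↦ 0) j) (fun a ↦ Fin.cases (0 : ℝ) (fun b ↦ P s a b) j) i with hQ
      have hνT : ∀ i : Fin 4, ν i (s + T) = ∑ j : Fin 4, Q i j • ν j s := by
        intro i
        refine Fin.cases ?_ (fun a ↦ ?_) i
        · rw [Fin.sum_univ_succ]
          simp only [hQ, Matrix.of_apply, Fin.cases_zero, Fin.cases_succ, one_smul, zero_smul,
            Finset.sum_const_zero, add_zero]
          exact hν0per s hs
        · rw [Fin.sum_univ_succ]
          simp only [hQ, Matrix.of_apply, Fin.cases_zero, Fin.cases_succ, zero_smul, zero_add]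
          exact hexp s hs a
      have hfT' : ∀ k, f T k = (ν (ι k) (s + T) : E) := fun k ↦
        frame_congr_arg (I := I) (ν (ι k)) (by rw [hclT])
      have hf0' : ∀ l, f 0 l = (ν (ι l) s : E) := fun l ↦
        frame_congr_arg (I := I) (ν (ι l)) (by rw [hcl0, add_zero])
      have hfT : ∀ k, f T k = ∑ l, Q (ι k) (ι l) • B₀ l := by
        intro k
        rw [hfT', hνT (ι k), hB₀]
        simp only [hf0']
        exact (Equiv.sum_comp ι (fun j ↦ Q (ι k) j • ν j s)).symm
      have hrepr : ∀ k l, B₀.repr (f T k) l = Q (ι k) (ι l) := fun k l ↦ by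
        rw [hfT k, B₀.repr_sum_self]
      have hdetQ : B₀.det (f T) = Q.det := by
        rw [Basis.det_apply]
        have hm : B₀.toMatrix (f T) = (Q.submatrix ι ι)ᵀ := by
          ext l k
          rw [Basis.toMatrix_apply, hrepr, Matrix.transpose_apply, Matrix.submatrix_apply]
        rw [hm, Matrix.det_transpose, Matrix.det_submatrix_equiv_self]
      rw [hdetL', hdetQ, hQ, det_blockOnePThree] at hdetL
      exact hdetL
    nlinarith [hsq, hpos]
  exact ⟨ν, P, hon, hsm, hν0, hν0per, hexp, hPsm, fun s hs ↦ ⟨hPtP s hs, hdet s hs⟩⟩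

end Monodromy

end Literature.Geometry.Riemannian

end
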